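import Mathlib
import Summits.ResolutionOfSingularities.ResolutionOfSingularities.Theorems.RadicialJungCleanModelsBirthDescent
import HarnessLib

/-!
# Route `RadicialJung`, crux `CleanModels` (stmt-ResolutionOfSingularities-15917), line `Sketch` rev 35, stub 6 `stub_cleanProp44` (X44c),
# `τ = 1` residual, the corner `λ' ≡ 0` ((B5′) of memo 4e §2.6 (d)): THE COUNT FOR AN ARBITRARY DERIVATION — ARITHMETIC DERIVATIONS OF `κ(c)`
# count the births at NON-RATIONAL points, separable or not

Seat decomp-res-hand-2 g12 (structural hand); fourth algebraic brick.  ✓ `…BirthDescent.lean` counts births with the derivation `d/du` of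
`κ(c)[u]`, which is silent in the corner `F' = 0` (`F ∈ κ[u^p] ∖ κ[u]^p`, imperfect `κ = κ(c)` only); ✓ `…BirthCorner.lean` /
`…BirthCornerSeparable.lean` treat the rational and separable points of the corner by normal forms.  The observation of this file: the §1 mechanism
of `…BirthDescent.lean` works for ANY derivation `D` of the ring `κ[u]` — Leibniz alone makes `D` kill `p`-th powers and lower `π`-adic orders by at
most one —, in particular for the COEFFICIENTWISE («arithmetic») derivation `D = ∂ ⊗ 1` induced by a derivation `∂` of the imperfect field `κ`
(Mathlib: `Differential.mapCoeffs`), for which `deg D F ≤ deg F ≤ δ` and `D F ≠ 0` as soon as `∂` moves some coefficient of `F` (for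
`F ∉ κ^p[u]`, e.g. `F ∈ κ[u^p] ∖ κ[u]^p`, such a `∂` exists by the `p`-basis theorem [Matsumura, Commutative Ring Theory, Thm. 26.5] — NOT
formalized here: `D` / the differential structure is a datum of the statements):

* `births_apply_pow_char_eq_zero`, `births_pow_dvd_apply_of_pow_succ_dvd(_sub_pow)` — `D(G^p) = 0`, `π^{k+1} ∣ F − G^p ⟹ π^k ∣ D F`.
* `births_weighted_count_le_of_derivation` — **THE COUNT**: `D F ≠ 0`, `deg (D F) ≤ δ'`, pairwise coprime `π_i` with `π_i^{n_i} ∣ F − G_i^p` ⟹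
  `Σ_i (n_i − 1)·deg π_i ≤ δ'` (for `d/du`: `δ' = δ − 2`, ✓ `births_weighted_count_le`; for `∂ ⊗ 1`: `δ' = δ`).
* `births_le_of_derivation` — each point: `(n − 1)·deg π ≤ δ'`; hence (`births_lt_of_derivation_of_two_le_natDegree`) at a closed point of DEGREE
  `≥ 2` — every non-rational point, separable or inseparable — `2(n − 1) ≤ δ'`, i.e. STRICT DESCENT `ν(c') < δ` as soon as `δ' = δ ≥ 3`.
* `births_natDegree_mapCoeffs_le`, `births_mapCoeffs_ne_zero_iff` — the coefficientwise derivation of a differential ring satisfies the degree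
  hypothesis, and `D F ≠ 0 ⟺` some coefficient of `F` has `∂ ≠ 0`; `births_corner_count_mapCoeffs` — the corner count with `δ' = deg F`.

NET CENSUS of the corner (B5′) after the four bricks (for the planner; dictionary NOT formalized): given a derivation `∂` of `κ(c)` moving a
coefficient of `F` (exists iff `F ∉ κ^p[u]`), EVERY closed point of `Γ''` of degree `≥ 2` descends strictly (`δ ≥ 3`) and the births are counted
(`Σ (n_i − 1) deg π_i ≤ δ`); at RATIONAL points `δ*` is non-increasing with at most ONE non-descending birth, of maximal-contact normal form
`F = P^p + a(u − α)^δ`.  What remains of (B′)/(B5′) as mathematics: the termination of that unique unbranched rational chain (plus the small cases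
`δ ≤ 2`), and the `p`-basis existence statement if one wants it inside Lean.

Honest framing: OURS, elementary (`Derivation`, `Differential.mapCoeffs`); nothing here proves (B5′), the hypotheses of `cleanProp44_of_tauOneResidual`,
X44c, any case of `CleanModels`, or resolution of singularities in characteristic `p`.  Setting only:
[cite: CossartPiltant2008, Lemma 4.3 (5), Prop. 4.4] [cite: CossartJannsenSaito2020, Thm. 4.22, Cor. 4.23, Rem. 6.29].
-/

set_option linter.dupNamespace false -- mandated namespace of this single-conjunct summit

open Polynomial Finset

namespace Summit.ResolutionOfSingularities.ResolutionOfSingularities.Theorems.RadicialJung.CleanModels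

/-! ## §1 Any derivation kills `p`-th powers and lowers `π`-adic orders by at most one -/

/-- A derivation of a ring of characteristic `p` kills `p`-th powers: `D(G^p) = p G^{p−1} D G = 0`. [folklore] -/
theorem births_apply_pow_char_eq_zero {R : Type*} [CommRing R] (p : ℕ) [CharP R p] (D : Derivation ℤ R R) (G : R) :
    D (G ^ p) = 0 := by
  rw [D.leibniz_pow, ← Nat.cast_smul_eq_nsmul R, CharP.cast_eq_zero R p, zero_smul]

/-- Leibniz: `π^{k+1} ∣ F ⟹ π^k ∣ D F` for any derivation `D` (no hypothesis on `π`). [folklore] -/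
theorem births_pow_dvd_apply_of_pow_succ_dvd {R : Type*} [CommRing R] (D : Derivation ℤ R R) {π F : R} {k : ℕ}
    (h : π ^ (k + 1) ∣ F) : π ^ k ∣ D F := by
  obtain ⟨w, rfl⟩ := h
  rw [D.leibniz, D.leibniz_pow, Nat.add_sub_cancel]
  simp only [smul_eq_mul, nsmul_eq_mul]
  exact dvd_add (Dvd.dvd.mul_right (pow_dvd_pow π (Nat.le_succ k)) _)
    (Dvd.dvd.mul_left (Dvd.dvd.mul_left (Dvd.intro _ rfl) _) _)

/-- **`π^{k+1} ∣ F − G^p ⟹ π^k ∣ D F`** for any derivation `D` of a ring of characteristic `p`. [folklore] -/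
theorem births_pow_dvd_apply_of_pow_succ_dvd_sub_pow {R : Type*} [CommRing R] (p : ℕ) [CharP R p] (D : Derivation ℤ R R)
    {π F G : R} {k : ℕ} (h : π ^ (k + 1) ∣ F - G ^ p) : π ^ k ∣ D F := by
  have h' := births_pow_dvd_apply_of_pow_succ_dvd D h
  rwa [map_sub, births_apply_pow_char_eq_zero p D G, sub_zero] at h'

/-- Divisibility form of `ν(c') ≤ 1 + ord_{c'}(D F)`: `π^n ∣ F − G^p`, `π^m ∤ D F ⟹ n ≤ m`. [folklore] -/
theorem births_le_of_pow_dvd_sub_pow_of_not_dvd_apply {R : Type*} [CommRing R] (p : ℕ) [CharP R p] (D : Derivation ℤ R R)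
    {π F G : R} {n m : ℕ} (hn : π ^ n ∣ F - G ^ p) (hm : ¬ π ^ m ∣ D F) : n ≤ m := by
  rcases le_or_gt n m with h | hlt
  · exact h
  · exfalso
    obtain ⟨k, rfl⟩ : ∃ k, n = k + 1 := ⟨n - 1, by omega⟩
    exact hm ((pow_dvd_pow π (by omega : m ≤ k)).trans (births_pow_dvd_apply_of_pow_succ_dvd_sub_pow p D hn))

/-! ## §2 The count for an arbitrary derivation of `K[u]` -/

/-- **THE COUNT FOR A DERIVATION**: `D` any derivation of `K[u]` (`K` a field of characteristic `p`) with `D F ≠ 0` and `deg D F ≤ δ'`; then over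
any family of pairwise coprime `π_i` with `π_i^{n_i} ∣ F − G_i^p`, `Σ_i (n_i − 1)·deg π_i ≤ δ'`. [folklore] -/
theorem births_weighted_count_le_of_derivation {K : Type*} [Field K] (p : ℕ) [CharP K p] (D : Derivation ℤ K[X] K[X])
    {F : K[X]} {δ' : ℕ} (hDF : D F ≠ 0) (hdeg : (D F).natDegree ≤ δ')
    {ι : Type*} (s : Finset ι) (π : ι → K[X]) (hcop : (s : Set ι).Pairwise (Function.onFun IsCoprime π))
    (n : ι → ℕ) (G : ι → K[X]) (hdvd : ∀ i ∈ s, π i ^ n i ∣ F - G i ^ p) :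
    ∑ i ∈ s, (n i - 1) * (π i).natDegree ≤ δ' := by
  refine le_trans (births_sum_mul_natDegree_le_natDegree s π (fun i => n i - 1) hcop hDF fun i hi => ?_) hdeg
  rcases Nat.eq_zero_or_pos (n i) with h0 | hpos
  · simp [h0]
  · obtain ⟨m, hm⟩ : ∃ m, n i = m + 1 := ⟨n i - 1, by omega⟩
    have h := hdvd i hi
    rw [hm] at h
    show π i ^ (n i - 1) ∣ D F
    rw [hm, Nat.add_sub_cancel]
    exact births_pow_dvd_apply_of_pow_succ_dvd_sub_pow p D h

/-- One point: `(n − 1)·deg π ≤ δ'`. [folklore] -/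
theorem births_le_of_derivation {K : Type*} [Field K] (p : ℕ) [CharP K p] (D : Derivation ℤ K[X] K[X])
    {F : K[X]} {δ' : ℕ} (hDF : D F ≠ 0) (hdeg : (D F).natDegree ≤ δ')
    {π G : K[X]} {n : ℕ} (hn : π ^ n ∣ F - G ^ p) : (n - 1) * π.natDegree ≤ δ' := by
  have h := births_weighted_count_le_of_derivation p D hDF hdeg ({()} : Finset Unit) (fun _ => π)
    (by simp [Set.Pairwise]) (fun _ => n) (fun _ => G) (fun _ _ => hn)
  rwa [Finset.sum_singleton] at h

/-- **STRICT DESCENT AT EVERY POINT OF DEGREE `≥ 2`** (non-rational points, separable or not): `2(n − 1) ≤ δ'`, so `n < δ'` once `δ' ≥ 3`.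
[folklore] -/
theorem births_lt_of_derivation_of_two_le_natDegree {K : Type*} [Field K] (p : ℕ) [CharP K p] (D : Derivation ℤ K[X] K[X])
    {F : K[X]} {δ' : ℕ} (hDF : D F ≠ 0) (hdeg : (D F).natDegree ≤ δ') (hδ' : 3 ≤ δ')
    {π G : K[X]} (h2 : 2 ≤ π.natDegree) {n : ℕ} (hn : π ^ n ∣ F - G ^ p) : 2 * (n - 1) ≤ δ' ∧ n < δ' := by
  have h := births_le_of_derivation p D hDF hdeg hn
  have h' : 2 * (n - 1) ≤ δ' :=
    calc 2 * (n - 1) = (n - 1) * 2 := mul_comm _ _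
      _ ≤ (n - 1) * π.natDegree := Nat.mul_le_mul_left _ h2
      _ ≤ δ' := h
  exact ⟨h', by omega⟩

/-! ## §3 The coefficientwise derivation of a differential field -/

/-- The coefficientwise derivation does not raise degrees. [folklore] -/
theorem births_natDegree_mapCoeffs_le {K : Type*} [CommRing K] [Differential K] (F : K[X]) :
    (Differential.mapCoeffs F).natDegree ≤ F.natDegree := by
  rw [natDegree_le_iff_coeff_eq_zero]
  intro N hN
  rw [Differential.coeff_mapCoeffs, coeff_eq_zero_of_natDegree_lt hN]
  exact map_zero _

/-- `(∂ ⊗ 1) F ≠ 0` iff `∂` moves some coefficient of `F`. [folklore] -/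
theorem births_mapCoeffs_ne_zero_iff {K : Type*} [CommRing K] [Differential K] (F : K[X]) :
    Differential.mapCoeffs F ≠ 0 ↔ ∃ i, Differential.deriv (F.coeff i) ≠ 0 := by
  constructor
  · intro h
    by_contra hall
    push Not at hall
    apply h
    ext i
    rw [Differential.coeff_mapCoeffs, coeff_zero, hall i]
  · rintro ⟨i, hi⟩ h
    apply hi
    rw [← Differential.coeff_mapCoeffs, h, coeff_zero]

/-- **THE CORNER COUNT BY AN ARITHMETIC DERIVATION**: `K` a differential field of characteristic `p` whose derivation moves some coefficient of `F`;
then over pairwise coprime `π_i` with `π_i^{n_i} ∣ F − G_i^p`, `Σ (n_i − 1)·deg π_i ≤ deg F` (`≤ δ`): births at all closed points — rational,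
separable, inseparable — are counted, with no hypothesis on `F'`. [folklore] -/
theorem births_corner_count_mapCoeffs {K : Type*} [Field K] [Differential K] (p : ℕ) [CharP K p] {F : K[X]}
    (hDF : ∃ i, Differential.deriv (F.coeff i) ≠ 0)
    {ι : Type*} (s : Finset ι) (π : ι → K[X]) (hcop : (s : Set ι).Pairwise (Function.onFun IsCoprime π))
    (n : ι → ℕ) (G : ι → K[X]) (hdvd : ∀ i ∈ s, π i ^ n i ∣ F - G i ^ p) :
    ∑ i ∈ s, (n i - 1) * (π i).natDegree ≤ F.natDegree :=
  births_weighted_count_le_of_derivation p Differential.mapCoeffs ((births_mapCoeffs_ne_zero_iff F).mpr hDF)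
    (births_natDegree_mapCoeffs_le F) s π hcop n G hdvd

/-- **Strict descent at non-rational points in the corner**: with `K`, `F` as above and `3 ≤ deg F` (so `δ ≥ 3`), a closed point `π` of degree
`≥ 2` with `π^n ∣ F − G^p` has `n < deg F ≤ δ`. [folklore] -/
theorem births_corner_lt_of_two_le_natDegree {K : Type*} [Field K] [Differential K] (p : ℕ) [CharP K p] {F : K[X]}
    (hDF : ∃ i, Differential.deriv (F.coeff i) ≠ 0) (h3 : 3 ≤ F.natDegree)
    {π G : K[X]} (h2 : 2 ≤ π.natDegree) {n : ℕ} (hn : π ^ n ∣ F - G ^ p) : n < F.natDegree :=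
  (births_lt_of_derivation_of_two_le_natDegree p Differential.mapCoeffs ((births_mapCoeffs_ne_zero_iff F).mpr hDF)
    (births_natDegree_mapCoeffs_le F) h3 h2 hn).2

end Summit.ResolutionOfSingularities.ResolutionOfSingularities.Theorems.RadicialJung.CleanModels
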